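import Mathlib
import Literature.MathematicalPhysics.StatisticalMechanics.BarlowStacking
import Summits.AtomisticToContinuum.Crystallization.Theorems.BraggSlacknessRigidityHcpDiffractionRigidityEssentialPeriodicityOfArith
import Summits.AtomisticToContinuum.Crystallization.Theorems.BraggSlacknessRigidityHcpDiffractionRigidityWindowsOfEssentialPeriodicity
import Summits.AtomisticToContinuum.Crystallization.Theorems.BraggSlacknessRigidityHcpDiffractionRigidityPlainConfinementTransc
import Summits.AtomisticToContinuum.Crystallization.Theorems.BraggSlacknessRigidityHcpDiffractionRigidityDualArithTransc

/-!
# The essential period lattice, transcendental template (helper stub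
# `stub_essentialPeriodLatticeTransc` of crux `HcpDiffractionRigidity`, item `stmt-AtomisticToContinuum-13166`)

For the hcp template with `h²/a²` transcendental over `ℚ`, a `δ`-separated `Λ ∋ 0` all of whose pair
distances are template distances and whose Gaussian windows are quiet off the Bragg set has an
ESSENTIAL PERIOD LATTICE: a discrete full-rank `ℤ`-module `N ⊆ Λ − Λ` with `k • Λ ⊆ N`.
Assembly of: plain confinement `Λ ⊆ N'` (Gram pencil, `stub_plainConfinementTransc`), the periods
`V = N'^*` of `|S_t|²`, the dual arithmetic lemma (`stub_dualArithTransc`), the generic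
essential-periodicity theorem `stub_essentialPeriodicityOfArith`, and the remark that an essential
period is a difference (its bad squared-Gaussian mass is eventually below the total mass `≥ 1`).
This is the research kernel `stub_essentialPeriodLattice` restricted to transcendental `h²/a²`;
the algebraic-irrational case remains open.

All `[folklore]` as assembly.
-/

noncomputable section

namespace Summit.AtomisticToContinuum.Crystallization.Theorems

open Filter Topology
open scoped RealInnerProductSpace Classical
open Literature.MathematicalPhysics.StatisticalMechanics
open HcpRigidityWindows

/-- **Registered helper stub: the essential period lattice, transcendental case.** For the hcp
template with `h²/a²` transcendental, a `δ`-separated `Λ ∋ 0` all of whose pair distances are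
template distances and whose Gaussian windows are quiet off the Bragg set has an essential period
lattice: a discrete full-rank `ℤ`-module `N ⊆ Λ − Λ` with `k • Λ ⊆ N`.  (Plain confinement
`Λ ⊆ N'` by the Gram pencil; periods `V = N'^*`; the dual arithmetic lemma; the generic
essential-periodicity theorem B2b₀ with the same scales; an essential period is a difference
because its bad squared-Gaussian mass is eventually smaller than the total mass `≥ 1`.)
[folklore] -/
theorem stub_essentialPeriodLatticeTransc : ∀ (a h : ℝ) (ha : a ≠ 0) (hh : h ≠ 0), Transcendental ℚ (h ^ 2 / a ^ 2) → ∀ δ : ℝ, 0 < δ → ∀ Λ : Set (EuclideanSpace ℝ (Fin 3)), (∀ p ∈ Λ, ∀ q ∈ Λ, p ≠ q → δ ≤ dist p q) → (0 : EuclideanSpace ℝ (Fin 3)) ∈ Λ → (∀ p ∈ Λ, ∀ q ∈ Λ, ∃ a' ∈ (Literature.MathematicalPhysics.StatisticalMechanics.hcpPeriodicConfiguration ha hh).points, ∃ b' ∈ (Literature.MathematicalPhysics.StatisticalMechanics.hcpPeriodicConfiguration ha hh).points, dist p q = dist a' b') → (∃ L : ℕ → ℝ, Filter.Tendsto L Filter.atTop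 Filter.atTop ∧ ∀ g : EuclideanSpace ℝ (Fin 3) → ℝ, Continuous g → HasCompactSupport g → (∀ ξ ∈ tsupport g, ξ ≠ 0 ∧ ∀ k : EuclideanSpace ℝ (Fin 3), (∀ v ∈ (Literature.MathematicalPhysics.StatisticalMechanics.hcpPeriodicConfiguration ha hh).lattice, ∃ n : ℤ, inner ℝ k v = (n : ℝ)) → ‖ξ‖ ≠ ‖k‖) → ∀ ε : ℝ, 0 < ε → ∀ᶠ t : ℕ in Filter.atTop, (∫ ξ, g ξ * ‖∑' s : Λ, (Real.exp (-(‖(s : EuclideanSpace ℝ (Fin 3))‖ ^ 2) / L t ^ 2) : ℂ) * Complex.exp (2 * Real.pi * Complex.I * (inner ℝ ξ (s : EuclideanSpace ℝ (Fin 3)) : ℂ))‖ ^ 2) ≤ ε * ∑' s : Λ, Real.exp (-(‖(s : EuclideanSpace ℝ (Fin 3))‖ ^ 2) / L t ^ 2) ^ 2) → ∃ (N : Submodule ℤ (EuclideanSpace ℝ (Fin 3))) (k : ℕ), DiscreteTopology N ∧ Submodule.span ℝ (N : Set (EuclideanSpace ℝ (Fin 3))) = ⊤ ∧ 0 < k ∧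 (∀ z ∈ N, ∃ p ∈ Λ, ∃ q ∈ Λ, z = p - q) ∧ (∀ p ∈ Λ, (k : ℤ) • p ∈ N) := by
  intro a h ha hh ht δ hδ Λ hsep h0 hE hQ
  obtain ⟨N, D, hNd, hNspan, hD, hgram, hΛN⟩ := stub_plainConfinementTransc a h ha hh ht Λ h0 hE
  obtain ⟨k, hk, harith⟩ := stub_dualArithTransc a h ha hh ht N D hD hNd hNspan hgram
  obtain ⟨L, hL, hquiet⟩ := hQ
  haveI := hNd
  -- the periods of `|S_t|²`: the dual lattice of `N`
  obtain ⟨V, hVdef⟩ : ∃ V : Set (EuclideanSpace ℝ (Fin 3)),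
      V = {m | ∀ s ∈ N, ∃ n : ℤ, ⟪m, s⟫ = (n : ℝ)} := ⟨_, rfl⟩
  have hV : ∀ m ∈ V, ∀ s ∈ Λ, ∃ n : ℤ, ⟪m, s⟫ = (n : ℝ) := fun m hm s hs => by
    rw [hVdef] at hm; exact hm s (hΛN hs)
  have harith' : ∀ ξ : EuclideanSpace ℝ (Fin 3), (∀ m ∈ V, ¬ (ξ + m ≠ 0 ∧
      ∀ k' : EuclideanSpace ℝ (Fin 3), (∀ v ∈ (hcpPeriodicConfiguration ha hh).lattice,
        ∃ n : ℤ, ⟪k', v⟫ = (n : ℝ)) → ‖ξ + m‖ ≠ ‖k'‖)) →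
      ∀ z ∈ N, ∃ n : ℤ, (k : ℝ) * ⟪ξ, z⟫ = (n : ℝ) := fun ξ hξ =>
    harith ξ fun m hm => hξ m (by rw [hVdef]; exact hm)
  obtain ⟨M', k', hk', hM'N, hkN, hess⟩ := stub_essentialPeriodicityOfArith
    (hcpPeriodicConfiguration ha hh) δ hδ Λ hsep N hNd hΛN L hL hquiet V hV k hk harith'
  refine ⟨M', k', discreteTopology_of_le hNd hM'N, span_eq_top_of_smul_mem hNspan hk' hkN, hk',
    fun z hz => ?_, fun p hp => hkN p (hΛN hp)⟩
  -- an essential period is a difference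
  by_contra hne
  push Not at hne
  have hbad : ∀ s : Λ, (s : EuclideanSpace ℝ (Fin 3)) + z ∉ Λ := fun s hs =>
    hne _ hs _ s.2 (by abel)
  have h1 := (hess z hz).eventually (Iio_mem_nhds one_pos)
  obtain ⟨t, ht, hLt⟩ := (h1.and (hL.eventually_gt_atTop 0)).exists
  have hMG := one_le_tsum_gauss_sq hδ hsep h0 hLt
  have heq : (∑' s : Λ, if (s : EuclideanSpace ℝ (Fin 3)) + z ∈ Λ then (0 : ℝ) else
      Real.exp (-(‖(s : EuclideanSpace ℝ (Fin 3))‖ ^ 2) / L t ^ 2) ^ 2) =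
      ∑' s : Λ, Real.exp (-(‖(s : EuclideanSpace ℝ (Fin 3))‖ ^ 2) / L t ^ 2) ^ 2 :=
    tsum_congr fun s => if_neg (hbad s)
  rw [heq, div_self (by positivity)] at ht
  exact lt_irrefl _ ht

end Summit.AtomisticToContinuum.Crystallization.Theorems

end
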